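import Mathlib.Tactic.DeriveFintype
import Literature.Computability.Complexity.Transducers
import Literature.Computability.Complexity.UnaryArithMachines
import HarnessLib

/-!
# Bricks for the unary block format: the leading block of `1`s and the word after its terminator

Trunk toolkit, two finite-state transductions (`FST`, `Transducers.lean`: finite-state
transductions are linear-time `FP` functions, `FST.polyTimeComputable_eval`) for the total parser
`splitOnes` of the unary block format `1ᵃ 0 z` (`UnaryArithMachines.lean`):

* `onesPrefixFn w = 1^{(splitOnes w).1}` — the leading block of `1`s (`onesPrefixFn_mem_FP`);
* `afterZeroFn w = (splitOnes w).2` — the word after the first `0`, i.e. after the leading block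
  and its terminator (`afterZeroFn_mem_FP`);

with the evaluation rules on terminated blocks (`onesPrefixFn_ones_append`,
`afterZeroFn_ones_append`: on `1ᵃ 0 z` they return `1ᵃ` and `z`) and length bounds on every input.
They let a machine written in the algebra of `FP` functions (`BrickAlgebra.lean`) take apart words
of the shape `1^{2^m} 0 u` produced by the exponential pad `expPad 1` (`ExpPadding.lean`); first
consumer: the `2^{O(n / log n)}`-time machine of Hirahara's Cor. 6.4
(`MetaComplexity/UniversalHeuristicSchemes.lean`).

## References

* S. Arora, B. Barak, *Computational Complexity: A Modern Approach*, CUP 2009, §1.3 (unary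
  counters; robustness of polynomial time).
-/

namespace Literature.Computability.Complexity

open _root_.Computability

/-! ### The two functions -/

/-- `onesPrefixFn w = 1^{(splitOnes w).1}`: the leading block of `1`s of `w`. [folklore] -/
def onesPrefixFn (w : List Bool) : List Bool := ones (splitOnes w).1

/-- `afterZeroFn w = (splitOnes w).2`: the word after the leading block of `1`s and its
terminating `0` (empty if there is no `0`). [folklore] -/
def afterZeroFn (w : List Bool) : List Bool := (splitOnes w).2

/-- On a terminated block: `onesPrefixFn (1ᵃ 0 z) = 1ᵃ`. [folklore] -/
@[simp] theorem onesPrefixFn_ones_append (a : ℕ) (z : List Bool) :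
    onesPrefixFn (ones a ++ false :: z) = ones a := by
  simp [onesPrefixFn]

/-- On a terminated block: `afterZeroFn (1ᵃ 0 z) = z`. [folklore] -/
@[simp] theorem afterZeroFn_ones_append (a : ℕ) (z : List Bool) :
    afterZeroFn (ones a ++ false :: z) = z := by
  simp [afterZeroFn]

/-- `|onesPrefixFn w| ≤ |w|`. [folklore] -/
theorem length_onesPrefixFn_le (w : List Bool) : (onesPrefixFn w).length ≤ w.length := by
  have := splitOnes_le w
  simp only [onesPrefixFn, ones, List.length_replicate]
  omega

/-- `|afterZeroFn w| ≤ |w|`. [folklore] -/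
theorem length_afterZeroFn_le (w : List Bool) : (afterZeroFn w).length ≤ w.length := by
  have := splitOnes_le w
  simp only [afterZeroFn]
  omega

/-! ### The transducers -/

/-- States of the prefix transducer: inside the leading block, or past it. [folklore] -/
inductive OPS
  | run
  | done
  deriving DecidableEq, Fintype

/-- Transition of the prefix transducer: copy `1`s until the first `0`, then emit nothing.
[folklore] -/
def onesPrefixStep : OPS → Bool → OPS × List Bool
  | .run, true => (.run, [true])
  | .run, false => (.done, [])
  | .done, _ => (.done, [])

/-- The prefix transducer. [folklore] -/
def onesPrefixT : FST OPS Bool Bool where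
  init := .run
  step := onesPrefixStep
  front := fun _ => []
  keep := fun _ => true

/-- The transition of `onesPrefixT` (definitional). [folklore] -/
@[simp] theorem onesPrefixT_step (s : OPS) (b : Bool) : onesPrefixT.step s b = onesPrefixStep s b := rfl

/-- Past the block nothing is emitted. [folklore] -/
theorem onesPrefixT_run_done (w : List Bool) : (onesPrefixT.run .done w).2 = [] := by
  induction w with
  | nil => rfl
  | cons b w ih => cases b <;> simpa [FST.run_cons, onesPrefixStep] using ih

/-- Inside the block the leading `1`s are copied. [folklore] -/
theorem onesPrefixT_run_run (w : List Bool) : (onesPrefixT.run .run w).2 = ones (splitOnes w).1 := by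
  induction w with
  | nil => rfl
  | cons b w ih =>
    cases b
    · simpa [FST.run_cons, onesPrefixStep, splitOnes, ones] using onesPrefixT_run_done w
    · simpa [FST.run_cons, onesPrefixStep, splitOnes, ones, List.replicate_succ] using ih

/-- **The prefix transducer computes `onesPrefixFn`.** [folklore] -/
theorem onesPrefixT_eval (w : List Bool) : onesPrefixT.eval w = onesPrefixFn w := by
  have h : onesPrefixT.eval w = (onesPrefixT.run .run w).2 := by simp [FST.eval, onesPrefixT]
  rw [h, onesPrefixT_run_run, onesPrefixFn]

/-- **`onesPrefixFn ∈ FP`** (a finite-state transduction). [Arora–Barak 2009, §1.3] [folklore] -/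
theorem onesPrefixFn_mem_FP : onesPrefixFn ∈ FP := by
  obtain ⟨p, M, hM⟩ := onesPrefixT.polyTimeComputable_eval
  refine ⟨p, M, fun w => ?_⟩
  have h := hM w
  rw [show (id (onesPrefixT.eval w) : List Bool) = onesPrefixFn w from onesPrefixT_eval w] at h
  exact h

/-- States of the suffix transducer: skipping the leading block, or copying. [folklore] -/
inductive AZS
  | skip
  | copy
  deriving DecidableEq, Fintype

/-- Transition of the suffix transducer: emit nothing until the first `0` (not emitted either),
then copy. [folklore] -/
def afterZeroStep : AZS → Bool → AZS × List Bool
  | .skip, true => (.skip, [])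
  | .skip, false => (.copy, [])
  | .copy, b => (.copy, [b])

/-- The suffix transducer. [folklore] -/
def afterZeroT : FST AZS Bool Bool where
  init := .skip
  step := afterZeroStep
  front := fun _ => []
  keep := fun _ => true

/-- The transition of `afterZeroT` (definitional). [folklore] -/
@[simp] theorem afterZeroT_step (s : AZS) (b : Bool) : afterZeroT.step s b = afterZeroStep s b := rfl

/-- In the copying state the rest is copied. [folklore] -/
theorem afterZeroT_run_copy (w : List Bool) : (afterZeroT.run .copy w).2 = w := by
  induction w with
  | nil => rfl
  | cons b w ih => simpa [FST.run_cons, afterZeroStep] using ih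

/-- In the skipping state the output is the word after the first `0`. [folklore] -/
theorem afterZeroT_run_skip (w : List Bool) : (afterZeroT.run .skip w).2 = (splitOnes w).2 := by
  induction w with
  | nil => rfl
  | cons b w ih =>
    cases b
    · simpa [FST.run_cons, afterZeroStep, splitOnes] using afterZeroT_run_copy w
    · simpa [FST.run_cons, afterZeroStep, splitOnes] using ih

/-- **The suffix transducer computes `afterZeroFn`.** [folklore] -/
theorem afterZeroT_eval (w : List Bool) : afterZeroT.eval w = afterZeroFn w := by
  have h : afterZeroT.eval w = (afterZeroT.run .skip w).2 := by simp [FST.eval, afterZeroT]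
  rw [h, afterZeroT_run_skip, afterZeroFn]

/-- **`afterZeroFn ∈ FP`** (a finite-state transduction). [Arora–Barak 2009, §1.3] [folklore] -/
theorem afterZeroFn_mem_FP : afterZeroFn ∈ FP := by
  obtain ⟨p, M, hM⟩ := afterZeroT.polyTimeComputable_eval
  refine ⟨p, M, fun w => ?_⟩
  have h := hM w
  rw [show (id (afterZeroT.eval w) : List Bool) = afterZeroFn w from afterZeroT_eval w] at h
  exact h

end Literature.Computability.Complexity
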